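import Mathlib
import HarnessLib
import Summits.Ventures.LatticeQCDFlow.Exactness.PTBCCabibboMarinariErgodic
import Summits.Ventures.LatticeQCDFlow.Exactness.WilsonHeatBathErgodic

/-!
# The PTBC objects on the torus: the defect-weighted Wilson action and the lattice translation; PTBC for Wilson replicas is uniformly ergodic

HONEST FRAMING: exact (Metropolis-corrected) sampling algorithms for lattice gauge theory;
figures of merit are autocorrelation/cost numbers at stated couplings and volumes; no
continuum-physics claim.

Venture `LatticeQCDFlow` (cell pub-lqcd), topic `Exactness`, FANOUT row 9 (eng-latcore, the
engine `latflow.core.gauge4d` / `ptbc`: «the action becomes `S = β Σ_p w_p (1 − Re tr U_p/N)`;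
HB/OR/Metropolis/HMC/flow all honour it (staple sums are weighted)» — replica `q` of the PTBC ladder
carries the weights `w q` (`= 1` off the defect, `c(q)` on it; the periodic replica has all weights
equal), and the periodic replica is translated by a lattice vector).  NEW WORK of the cell over the
tree (the Literature torus objects `Site`, `Edge`, `Plaquette`, `plaquetteHolonomy`, `wilsonAction` of
`ConstructiveQFTWave0`, used by name; `PTBCTranslationErgodic.lean`: `ptbc_full_uniformlyErgodic`;
`PTBCCabibboMarinariErgodic.lean`; Literature `HeatKernelGroupMeasureProofs.continuous_plaquetteHolonomy`).
Nothing here is cited as a fact.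

* §1 `edgeTranslate v` (`(x, i) ↦ (v + x, i)`), **`configTranslate v : GaugeConfig ≃ᵐ GaugeConfig`**
  (`U ↦ U ∘ edgeTranslate v`); **`measurePreserving_comp_equiv`** (precomposition with a bijection of
  the index preserves a product of equal laws) ⇒ `measurePreserving_configTranslate`;
  `plaquetteHolonomy_configTranslate`.
* §2 **`weightedWilsonAction w ρ U = Σ_p w_p (N − Re tr ρ(U_p))`** (the engine's defect-weighted
  action up to the factor `β/N` absorbed in `w`); `weightedWilsonAction_one` (`w ≡ 1` gives the
  Literature `wilsonAction`); `continuous_weightedWilsonAction`, `weightedWilsonAction_bounded`,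
  **`weightedWilsonAction_configTranslate`** (constant weights: translation invariant).
* §3 **`ptbc_wilson_uniformlyErgodic`** — any compact second-countable `G`, continuous `ρ`, replicas
  `q : R` with weights `w q`, the translated replica `r₀` with constant weights: the PTBC cycle with
  exact heat-bath in-replica scans, swaps along any list of pairs and the translation by any lattice
  vector converges to `⊗_q Z_q⁻¹ e^{−S_q}·Haar^{⊗edges}` from EVERY start, which is its ONLY invariant
  probability law; **`ptbc_wilson_cabibboMarinari_uniformlyErgodic`** — the same for `SU(n)` with the
  Cabibbo–Marinari in-replica sweeps (rows 22–24).

NOT CLAIMED: rates; swap statistics; that HB/OR of the engine with WEIGHTED staples is the exact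
heat bath for the weighted action (it is the same single-link law with the weighted staple sum — the
tree's heat-bath theorems are stated for an arbitrary joint density, so they apply; not re-derived).
-/

noncomputable section

namespace Summit.Ventures.LatticeQCDFlow.Exactness

open MeasureTheory ProbabilityTheory Set Function
open Literature.MathematicalPhysics.QuantumFieldTheory
open scoped ENNReal

/-! ## §1 The lattice translation -/

section Translate

variable {d L : ℕ} [NeZero L]

/-- Translate an edge by the lattice vector `v`: `(x, i) ↦ (v + x, i)`. -/
def edgeTranslate (v : Site d L) : Edge d L ≃ Edge d L :=
  (Equiv.addLeft v).prodCongr (Equiv.refl (Fin d))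

omit [NeZero L] in
/-- `edgeTranslate v (x, i) = (v + x, i)`. -/
@[simp] theorem edgeTranslate_apply (v x : Site d L) (i : Fin d) : edgeTranslate v (x, i) = (v + x, i) := rfl

variable {G : Type*} [MeasurableSpace G]

/-- **Precomposition with a bijection of the index preserves the product of equal laws.** -/
theorem measurePreserving_comp_equiv {α : Type*} [Fintype α] (σ : α ≃ α) (ν : Measure G) [SigmaFinite ν] :
    MeasurePreserving (fun U : α → G => U ∘ σ) (Measure.pi fun _ : α => ν) (Measure.pi fun _ : α => ν) := by
  have hmeas : Measurable fun U : α → G => U ∘ σ := measurable_pi_lambda _ fun _ => measurable_pi_apply _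
  refine ⟨hmeas, (Measure.pi_eq fun t ht => ?_).symm⟩
  rw [Measure.map_apply hmeas (MeasurableSet.univ_pi ht)]
  have hpre : (fun U : α → G => U ∘ σ) ⁻¹' Set.pi univ t = Set.pi univ fun q => t (σ.symm q) := by
    ext U
    simp only [mem_preimage, mem_univ_pi, comp_apply]
    constructor
    · intro h q
      have h' := h (σ.symm q)
      rwa [Equiv.apply_symm_apply] at h'
    · intro h q
      have h' := h (σ q)
      rwa [Equiv.symm_apply_apply] at h'
  rw [hpre, Measure.pi_pi]
  exact Fintype.prod_equiv σ.symm _ _ fun q => rfl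

/-- **The lattice translation of a gauge configuration**, `U ↦ U ∘ edgeTranslate v`, as a measurable
bijection. -/
def configTranslate (v : Site d L) : GaugeConfig d L G ≃ᵐ GaugeConfig d L G where
  toFun U := U ∘ edgeTranslate v
  invFun U := U ∘ (edgeTranslate v).symm
  left_inv U := by funext e; simp only [comp_apply, Equiv.apply_symm_apply]
  right_inv U := by funext e; simp only [comp_apply, Equiv.symm_apply_apply]
  measurable_toFun := measurable_pi_lambda _ fun _ => measurable_pi_apply _
  measurable_invFun := measurable_pi_lambda _ fun _ => measurable_pi_apply _

omit [NeZero L] in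
/-- `configTranslate v U = U ∘ edgeTranslate v`. -/
theorem configTranslate_apply (v : Site d L) (U : GaugeConfig d L G) : configTranslate v U = U ∘ edgeTranslate v := rfl

/-- The translation preserves product Haar (any equal link laws). -/
theorem measurePreserving_configTranslate (v : Site d L) (ν : Measure G) [SigmaFinite ν] :
    MeasurePreserving (configTranslate (G := G) v) (Measure.pi fun _ : Edge d L => ν) (Measure.pi fun _ : Edge d L => ν) :=
  measurePreserving_comp_equiv (edgeTranslate v) ν

variable [Group G]

omit [NeZero L] in
/-- The translated configuration's plaquette holonomy at `x` is the original one at `v + x`. -/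
theorem plaquetteHolonomy_configTranslate (v : Site d L) (U : GaugeConfig d L G) (x : Site d L) (i j : Fin d) :
    plaquetteHolonomy (configTranslate v U) x i j = plaquetteHolonomy U (v + x) i j := by
  have hshift : ∀ (y : Site d L) (k : Fin d), v + y.shift k = (v + y).shift k := fun y k => by
    simp only [Site.shift, add_assoc]
  simp only [plaquetteHolonomy, configTranslate_apply, comp_apply, edgeTranslate_apply, hshift]

end Translate

/-! ## §2 The defect-weighted Wilson action -/

section Weighted

variable {d L N : ℕ} [NeZero L] {G : Type*} [Group G] (w : Plaquette d L → ℝ) (ρ : G →* Matrix (Fin N) (Fin N) ℂ)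

/-- **The defect-weighted Wilson action** `Σ_p w_p (N − Re tr ρ(U_p))` (the engine's
`β Σ_p w_p (1 − Re tr U_p/N)` with `β/N` absorbed in `w`). -/
def weightedWilsonAction (U : GaugeConfig d L G) : ℝ :=
  ∑ p : Plaquette d L, w p * ((N : ℝ) - (ρ (plaquetteHolonomy U p.1 p.2.1.1 p.2.1.2)).trace.re)

/-- Unit weights give the Literature Wilson action. -/
theorem weightedWilsonAction_one (U : GaugeConfig d L G) :
    weightedWilsonAction (fun _ => 1) ρ U = wilsonAction ρ U := by
  simp only [weightedWilsonAction, one_mul, wilsonAction]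

variable [TopologicalSpace G] [IsTopologicalGroup G]

/-- The weighted action is continuous for a continuous representation. -/
theorem continuous_weightedWilsonAction (hρ : Continuous ρ) : Continuous (weightedWilsonAction (d := d) (L := L) w ρ) := by
  unfold weightedWilsonAction
  refine continuous_finsetSum _ fun p _ => continuous_const.mul (continuous_const.sub ?_)
  exact Complex.continuous_re.comp ((continuous_id.matrix_trace).comp
    (hρ.comp (Literature.MathematicalPhysics.QuantumLattice.continuous_plaquetteHolonomy p.1 p.2.1.1 p.2.1.2)))

/-- On a compact group the weighted actions of finitely many replicas are uniformly bounded and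
measurable. -/
theorem weightedWilsonAction_bounded [CompactSpace G] [MeasurableSpace G] [BorelSpace G]
    [SecondCountableTopology G] {R : Type*} [Fintype R] (hρ : Continuous ρ) (wq : R → Plaquette d L → ℝ) :
    ∃ a b : ℝ, (∀ q U, a ≤ weightedWilsonAction (wq q) ρ U ∧ weightedWilsonAction (wq q) ρ U ≤ b) ∧
      ∀ q, Measurable (weightedWilsonAction (d := d) (L := L) (wq q) ρ) := by
  have hc : ∀ q, Continuous (weightedWilsonAction (d := d) (L := L) (wq q) ρ) := fun q =>
    continuous_weightedWilsonAction (wq q) ρ hρ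
  have hbound : ∀ q, ∃ C, ∀ U, |weightedWilsonAction (wq q) ρ U| ≤ C := fun q => by
    obtain ⟨C, hC⟩ := isCompact_univ.exists_bound_of_continuousOn (hc q).continuousOn
    exact ⟨C, fun U => (Real.norm_eq_abs _).symm.le.trans (hC U (mem_univ U))⟩
  choose C hC using hbound
  rcases isEmpty_or_nonempty R with hR | hR
  · exact ⟨0, 0, fun q => (IsEmpty.false q).elim, fun q => (IsEmpty.false q).elim⟩
  · refine ⟨-(Finset.univ.sup' Finset.univ_nonempty C), Finset.univ.sup' Finset.univ_nonempty C,
      fun q U => ⟨?_, ?_⟩, fun q => (hc q).measurable⟩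
    · have h := (abs_le.1 (hC q U)).1
      exact le_trans (neg_le_neg (Finset.le_sup' C (Finset.mem_univ q))) h
    · exact (abs_le.1 (hC q U)).2.trans (Finset.le_sup' C (Finset.mem_univ q))

omit [TopologicalSpace G] [IsTopologicalGroup G] in
/-- **Constant weights: the weighted action is translation invariant.** -/
theorem weightedWilsonAction_configTranslate [MeasurableSpace G] {c : ℝ} (hw : ∀ p, w p = c) (v : Site d L)
    (U : GaugeConfig d L G) :
    weightedWilsonAction w ρ (configTranslate v U) = weightedWilsonAction w ρ U := by
  unfold weightedWilsonAction
  simp only [hw]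
  refine Fintype.sum_equiv ((Equiv.addLeft v).prodCongr (Equiv.refl _)) _ _ fun p => ?_
  rw [plaquetteHolonomy_configTranslate]
  rfl

end Weighted

/-! ## §3 PTBC for Wilson replicas on the torus -/

section PTBC

variable {d L N : ℕ} [NeZero L] {G : Type*} [TopologicalSpace G] [Group G] [IsTopologicalGroup G] [CompactSpace G]
  [MeasurableSpace G] [BorelSpace G] [SecondCountableTopology G] (ρ : G →* Matrix (Fin N) (Fin N) ℂ)
  {R : Type*} [DecidableEq R] [Fintype R] (wq : R → Plaquette d L → ℝ)

/-- **PTBC FOR WILSON REPLICAS IS UNIFORMLY ERGODIC** (any compact second-countable gauge group,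
continuous `ρ`): replica `q` carries the defect-weighted action `weightedWilsonAction (wq q) ρ`, the
translated replica `r₀` has constant weights; one cycle = exact heat-bath scans over every edge on
every replica, the swaps along any list `P` of replica pairs, the translation of `r₀` by any lattice
vector `v`: `|μ₀ Cᵗ(A) − ptbcTarget(A)| ≤ (1 − ((e^{−b}/e^{−a})^{|l|})^{|Lr|})ᵗ` from EVERY initial law
(`a, b` the uniform action bounds), and `ptbcTarget` is the ONLY invariant probability law. -/
theorem ptbc_wilson_uniformlyErgodic (hρ : Continuous ρ) {r₀ : R} {c₀ : ℝ} (hw0 : ∀ p, wq r₀ p = c₀)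
    {l : List (Edge d L)} (hl : ∀ e, e ∈ l) {Lr : List R} (hLr : ∀ r, r ∈ Lr) (P : List (R × R)) (v : Site d L) :
    ∃ a b : ℝ, (∀ q U, a ≤ weightedWilsonAction (wq q) ρ U ∧ weightedWilsonAction (wq q) ρ U ≤ b) ∧
      (∀ (μ₀ : Measure (R → GaugeConfig d L G)) [IsProbabilityMeasure μ₀] (t : ℕ) (A : Set (R → GaugeConfig d L G)),
        |((fun ν : Measure (R → GaugeConfig d L G) =>
              ν.bind ((ptbcTranslation (configTranslate v) (configTranslate (G := G) v).measurable r₀ ∘ₖ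
                  ptbcSwaps (fun q => weightedWilsonAction (wq q) ρ) P) ∘ₖ
                replicaSweep (ptbcInReplica (fun _ : Edge d L => haarProbability G)
                  (ptbcDensity fun q => weightedWilsonAction (wq q) ρ) l) Lr))^[t] μ₀).real A
            - (ptbcTarget (fun _ : Edge d L => haarProbability G)
                (ptbcDensity fun q => weightedWilsonAction (wq q) ρ)).real A| ≤
          (1 - (((ENNReal.ofReal (Real.exp (-b)) * (ENNReal.ofReal (Real.exp (-a)))⁻¹) ^ l.length) ^ Lr.length).toReal) ^ t) ∧
      ∀ (Q : Measure (R → GaugeConfig d L G)) [IsProbabilityMeasure Q],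
        Kernel.Invariant ((ptbcTranslation (configTranslate v) (configTranslate (G := G) v).measurable r₀ ∘ₖ
            ptbcSwaps (fun q => weightedWilsonAction (wq q) ρ) P) ∘ₖ
          replicaSweep (ptbcInReplica (fun _ : Edge d L => haarProbability G)
            (ptbcDensity fun q => weightedWilsonAction (wq q) ρ) l) Lr) Q →
          Q = ptbcTarget (fun _ : Edge d L => haarProbability G) (ptbcDensity fun q => weightedWilsonAction (wq q) ρ) := by
  obtain ⟨a, b, hab, hmeas⟩ := weightedWilsonAction_bounded (d := d) (L := L) ρ hρ wq
  refine ⟨a, b, hab, fun μ₀ _ t A => ?_, fun Q _ hQ => ?_⟩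
  · exact ptbc_full_uniformlyErgodic (μ := fun _ : Edge d L => haarProbability G) hmeas hab hl hLr P
      (configTranslate v) (measurePreserving_configTranslate v (haarProbability G)) r₀
      (fun U => weightedWilsonAction_configTranslate (wq r₀) ρ hw0 v U) μ₀ t A
  · exact ptbcTarget_unique_invariant_full (μ := fun _ : Edge d L => haarProbability G) hmeas hab hl hLr P
      (configTranslate v) (measurePreserving_configTranslate v (haarProbability G)) r₀
      (fun U => weightedWilsonAction_configTranslate (wq r₀) ρ hw0 v U) hQ

/-- **THE SAME FOR `SU(n)` WITH CABIBBO–MARINARI IN-REPLICA SWEEPS** (rows 22–24: `ptbc` with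
`updates.sweep` on every replica; frames in lexicographic order or its reverse): for some `ε₀ > 0`,
`|μ₀ Cᵗ(A) − ptbcTarget(A)| ≤ (1 − ε₀^{|Lr|})ᵗ` from EVERY initial law, and `ptbcTarget` is the ONLY
invariant probability law. -/
theorem ptbc_wilson_cabibboMarinari_uniformlyErgodic {n : Type*} [Fintype n] [DecidableEq n] [Nonempty n]
    [LinearOrder n] {m : Type*} [Fintype m] [DecidableEq m]
    (ρn : Matrix.specialUnitaryGroup n ℂ →* Matrix (Fin N) (Fin N) ℂ) (hρ : Continuous ρn)
    {r₀ : R} {c₀ : ℝ} (hw0 : ∀ p, wq r₀ p = c₀) (frames : List (n ≃ Fin 2 ⊕ m))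
    (hlex : frames.map pairOf = lexPairs (Finset.univ.sort (· ≤ ·) : List n) ∨
      frames.map pairOf = (lexPairs (Finset.univ.sort (· ≤ ·) : List n)).reverse)
    {l : List (Edge d L)} (hl : ∀ e, e ∈ l) {Lr : List R} (hLr : ∀ r, r ∈ Lr) (P : List (R × R)) (v : Site d L) :
    ∃ ε₀ : ℝ≥0∞, 0 < ε₀ ∧
      (∀ (μ₀ : Measure (R → Cfg (Edge d L) n)) [IsProbabilityMeasure μ₀] (t : ℕ) (A : Set (R → Cfg (Edge d L) n)),
        |((fun ν : Measure (R → Cfg (Edge d L) n) =>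
              ν.bind ((ptbcTranslation (configTranslate v)
                    (configTranslate (G := Matrix.specialUnitaryGroup n ℂ) v).measurable r₀ ∘ₖ
                  ptbcSwaps (fun q => weightedWilsonAction (wq q) ρn) P) ∘ₖ
                replicaSweep (fun q => latSweep (ptbcDensity (fun q => weightedWilsonAction (wq q) ρn) q) frames l)
                  Lr))^[t] μ₀).real A
            - (ptbcTarget (linkHaar (Edge d L) n) (ptbcDensity fun q => weightedWilsonAction (wq q) ρn)).real A| ≤
          (1 - (ε₀ ^ Lr.length).toReal) ^ t) ∧
      ∀ (Q : Measure (R → Cfg (Edge d L) n)) [IsProbabilityMeasure Q],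
        Kernel.Invariant ((ptbcTranslation (configTranslate v)
              (configTranslate (G := Matrix.specialUnitaryGroup n ℂ) v).measurable r₀ ∘ₖ
            ptbcSwaps (fun q => weightedWilsonAction (wq q) ρn) P) ∘ₖ
          replicaSweep (fun q => latSweep (ptbcDensity (fun q => weightedWilsonAction (wq q) ρn) q) frames l) Lr) Q →
          Q = ptbcTarget (linkHaar (Edge d L) n) (ptbcDensity fun q => weightedWilsonAction (wq q) ρn) := by
  obtain ⟨a, b, hab, hmeas⟩ := weightedWilsonAction_bounded (d := d) (L := L) ρn hρ wq
  exact ptbc_cabibboMarinari_uniformlyErgodic hmeas hab frames hlex hl hLr P (configTranslate v)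
    (measurePreserving_configTranslate v (haarProbability (Matrix.specialUnitaryGroup n ℂ))) r₀
    (fun U => weightedWilsonAction_configTranslate (wq r₀) ρn hw0 v U)

end PTBC

end Summit.Ventures.LatticeQCDFlow.Exactness
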